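import Summits.ResolutionOfSingularities.ResolutionOfSingularities.Theorems.EquisingularLiftEquisingularLiftNatExactShadowPair
import Summits.ResolutionOfSingularities.ResolutionOfSingularities.Theorems.EquisingularLiftEquisingularLiftNatExactShadowSection
import Summits.ResolutionOfSingularities.ResolutionOfSingularities.Theorems.EquisingularLiftEquisingularLiftNatCarrierRigidity
import Literature.AlgebraicGeometry.Resolution.StalkIdealGenerization
import HarnessLib

/-!
# [OURS · L1 W4.5(b) · EL♮(3)] E-NEG(1), part 3b-ii — the ring-level inputs at `R = 𝒪_{X₁,q}` FROM the geometry of an exact shadow;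
# conclusion (iii) «`s ⊆ D♭`» of PLANNER-MEMO-g9-1 in FRAME currency, `hloc` discharged (crux `EquisingularLiftNatThree` =
# stmt-ResolutionOfSingularities-20148, parent stmt-20038)

NOT a statement of any manuscript. Helper file of the chain res-L1-w45b (cell `res-hironaka`, rung L, slot W4.5(b)); AI-written, weaker than
expert review; filed `--supports stmt-ResolutionOfSingularities-20148 --as helper`; it closes nothing. Object (O1) E-NEG(1) of res-L1-w45b-plan-1's
PLANNER-MEMO-g9-1 v1.1 (negative companion of the rungs v7′ / T-PROX; not load-bearing for `closes`), part 3b, second half.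

Part 2 (`…NatExactShadowSection.range_subset_image_support_of_exactShadow`, p529064) proved (iii) `s(Spec O) ⊆ D♭ := τ(supp C)` MODULO the local
input `hloc` («if `s(η) ∉ D♭`, the restricted centre at the point of `V(D♭)_red` under `q` is a quasi-regular pair in `𝔪`»); part 3b-i
(`…NatExactShadowPair.exists_isQuasiRegular_pair_of_stalkData`, p537428) produces `hloc`'s data from RING-LEVEL facts at the ambient stalk
`R = 𝒪_{X₁,q}`. Here those facts are DERIVED from the exact-shadow geometry, through the dictionary `Spec 𝒪_{X₁,q} → X₁` (Stacks 01J7; tree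
`GermsOfClosedSubsets`, `StalkIdealGenerization`): with `η` the generic point of the closed irreducible `D♭` and `𝔓 := 𝓘(D♭)_q = 𝔭_η`
(`stalkIdeal_vanishingIdeal_closure`) — `𝔓` is prime; HORIZONTALITY `D♭ ⊄ X₁,k` gives `ϖ ∉ 𝔓` (`Γgerm_mem_primeOfSpecializes_iff`); PLANARITY
`D♭ ⊆ supp J` (part 1 (i), `J` the carrier's ideal with `J_q = (c₀)`) gives `c₀ ∈ 𝔓`; the strict chains `η ⤳ ζ ⤳ q` (`ζ` a non-closed point of
the curve `closure (Γ ∖ q)` under `q`) and `(0) < (c₀) < 𝔓` (`J ⊄ D♭`: the carrier is not the shadow's image) give `dim R ⧸ 𝔓 = 2`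
(`ringKrullDim_quotient_eq_two_of_chain`); and `s(η_O) ∉ D♭` makes every prime over `𝔓 + (ker s)_q` maximal (the generisation it defines lies in
`D♭ ∩ s(Spec O) = {q}`).

CONTENT.
* `diff_support_subset_preimage_closedPoint_of_exactShadow`, `closure_diff_support_subset_of_exactShadow`,
  `image_support_inter_preimage_closedPoint_eq_of_exactShadow` — the curve `Γ ∖ supp ker s` and its closure lie in the special fibre and in
  `D♭`; `D♭ ∩ X₁,k = closure (Γ ∖ supp ker s)` (what a consumer uses to check `supp J ⊄ D♭` from `E_k ⊄ closure (Γ ∖ q)`).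
* **`range_subset_image_support_of_exactShadow_of_frame'`** (generic point `q` with `s(s₀) = q`) and
  **`range_subset_image_support_of_exactShadow_of_frame`** (`q := s(s₀)`) — E-NEG(1) (iii) `s(Spec O) ⊆ D♭` from: the exact-shadow SETTING of
  part 2, horizontality of `D♭`, a non-closed point `ζ ⤳ q` of `closure (Γ ∖ supp ker s)`, an ideal sheaf `J ⊇`-planar (`D♭ ⊆ supp J`,
  `supp J` irreducible, `supp J ⊄ D♭`), and the FRAME at `q`: `𝒪_{X₁,q}` regular of dimension `4`, `J_q = (c₀)` with `c₀ ∉ 𝔪²`, the uniformizer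
  germ `ϖ_R ∉ 𝔪² + (c₀)`, `(ker s)_q = (c₀, x₁, x₂)` (in-carrier section).

References: H. Matsumura, *Commutative Ring Theory* (1986), §5 p. 31, Thms. 14.2, 14.5, 17.4; The Stacks Project, Tags 01J7, 080E — through the
cited tree files. OURS planning text (index only): L/w45b/PLANNER-MEMO-g9-1.md v1.1 §1 (c1), (iii).
-/

set_option linter.dupNamespace false -- mandated namespace `Summit.<Summit>.<Problem>` of this single-conjunct summit
set_option linter.overlappingInstances false -- signatures carry `[IsDomain O] [IsDiscreteValuationRing O]`

noncomputable section

open CategoryTheory AlgebraicGeometry TopologicalSpace Topology IsLocalRing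
open AlgebraicGeometry.Scheme.IdealSheafData Literature.AlgebraicGeometry.Resolution

namespace Summit.ResolutionOfSingularities.ResolutionOfSingularities.Cruxes.EquisingularLiftNat.Sections

section ExactShadowStalk

variable {O : Type} [CommRing O] [IsDomain O] [IsDiscreteValuationRing O] {P X₁ X₂ : Scheme.{0}}
  [IsLocallyNoetherian X₁] [IsLocallyNoetherian X₂]

omit [IsLocallyNoetherian X₂] in
/-- In the exact-shadow SETTING, the curve `Γ ∖ supp ker s` lies in the special fibre of `X₁` (it is the image of points of
`Γ̃ = (supp C)_k`). [folklore] [OURS · L1 W4.5b] -/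
theorem diff_support_subset_preimage_closedPoint_of_exactShadow (r : P ⟶ Spec (.of O)) (τ₁ : X₁ ⟶ P) (s : Spec (.of O) ⟶ X₁)
    (τ : X₂ ⟶ X₁) (hτ : IsBlowup τ s.ker) (Γ : Set X₁) (C : X₂.IdealSheafData)
    (hCsp : (C.support : Set X₂) ∩ (CategoryStruct.comp τ (CategoryStruct.comp τ₁ r)) ⁻¹' {closedPoint O} =
      closure (τ ⁻¹' (Γ \ (s.ker.support : Set X₁)))) :
    Γ \ (s.ker.support : Set X₁) ⊆ (CategoryStruct.comp τ₁ r) ⁻¹' {closedPoint O} := by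
  intro y hy
  obtain ⟨c, hc⟩ := exists_preimage_of_not_mem_support τ s.ker hτ hy.2
  have h1 : c ∈ closure (τ ⁻¹' (Γ \ (s.ker.support : Set X₁))) := subset_closure (by rw [Set.mem_preimage, hc]; exact hy)
  rw [← hCsp] at h1
  have h2 := h1.2
  simp only [Set.mem_preimage, Scheme.Hom.comp_apply] at h2 ⊢
  rwa [hc] at h2

omit [IsLocallyNoetherian X₂] in
/-- In the exact-shadow SETTING, `closure (Γ ∖ supp ker s) ⊆ D♭ ∩ X₁,k`. [folklore] [OURS · L1 W4.5b] -/
theorem closure_diff_support_subset_of_exactShadow (r : P ⟶ Spec (.of O)) (τ₁ : X₁ ⟶ P) (s : Spec (.of O) ⟶ X₁)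
    (τ : X₂ ⟶ X₁) (hτ : IsBlowup τ s.ker) (Γ : Set X₁) (C : X₂.IdealSheafData)
    (hCsp : (C.support : Set X₂) ∩ (CategoryStruct.comp τ (CategoryStruct.comp τ₁ r)) ⁻¹' {closedPoint O} =
      closure (τ ⁻¹' (Γ \ (s.ker.support : Set X₁))))
    (hD : IsClosed (τ '' (C.support : Set X₂))) :
    closure (Γ \ (s.ker.support : Set X₁)) ⊆ τ '' (C.support : Set X₂) ∩ (CategoryStruct.comp τ₁ r) ⁻¹' {closedPoint O} := by
  have hF : IsClosed ((CategoryStruct.comp τ₁ r) ⁻¹' ({closedPoint O} : Set (Spec (.of O)))) :=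
    ((PrimeSpectrum.isClosed_singleton_iff_isMaximal _).mpr (IsLocalRing.maximalIdeal.isMaximal O)).preimage
      (CategoryStruct.comp τ₁ r).continuous
  refine closure_minimal (Set.subset_inter ?_
    (diff_support_subset_preimage_closedPoint_of_exactShadow r τ₁ s τ hτ Γ C hCsp)) (hD.inter hF)
  intro y hy
  obtain ⟨c, hc⟩ := exists_preimage_of_not_mem_support τ s.ker hτ hy.2
  have h1 : c ∈ closure (τ ⁻¹' (Γ \ (s.ker.support : Set X₁))) := subset_closure (by rw [Set.mem_preimage, hc]; exact hy)
  rw [← hCsp] at h1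
  exact ⟨c, h1.1, hc⟩

omit [IsLocallyNoetherian X₂] in
/-- **The special fibre of `D♭` is the curve**: `D♭ ∩ X₁,k = closure (Γ ∖ supp ker s)` in the exact-shadow SETTING (blow-ups are closed maps,
onto off the centre). A consumer checks `supp J ⊄ D♭` (the carrier is not the shadow's image) as `E_k ⊄ closure (Γ ∖ q)` through it.
[cite: GortzWedhorn2020, Prop. 13.91 (3)] [OURS · L1 W4.5b] -/
theorem image_support_inter_preimage_closedPoint_eq_of_exactShadow (r : P ⟶ Spec (.of O)) (τ₁ : X₁ ⟶ P) (s : Spec (.of O) ⟶ X₁)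
    (τ : X₂ ⟶ X₁) (hτ : IsBlowup τ s.ker) (Γ : Set X₁) (C : X₂.IdealSheafData)
    (hCsp : (C.support : Set X₂) ∩ (CategoryStruct.comp τ (CategoryStruct.comp τ₁ r)) ⁻¹' {closedPoint O} =
      closure (τ ⁻¹' (Γ \ (s.ker.support : Set X₁)))) :
    τ '' (C.support : Set X₂) ∩ (CategoryStruct.comp τ₁ r) ⁻¹' {closedPoint O} = closure (Γ \ (s.ker.support : Set X₁)) := by
  have himg : τ '' (τ ⁻¹' (Γ \ (s.ker.support : Set X₁))) = Γ \ (s.ker.support : Set X₁) := by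
    refine Set.Subset.antisymm (Set.image_preimage_subset _ _) fun y hy => ?_
    obtain ⟨c, hc⟩ := exists_preimage_of_not_mem_support τ s.ker hτ hy.2
    exact ⟨c, by rw [Set.mem_preimage, hc]; exact hy, hc⟩
  have h1 : τ '' (C.support : Set X₂) ∩ (CategoryStruct.comp τ₁ r) ⁻¹' {closedPoint O} =
      τ '' ((C.support : Set X₂) ∩ (CategoryStruct.comp τ (CategoryStruct.comp τ₁ r)) ⁻¹' {closedPoint O}) := by
    ext y
    constructor
    · rintro ⟨⟨c, hc, rfl⟩, hy⟩
      refine ⟨c, ⟨hc, ?_⟩, rfl⟩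
      simpa only [Set.mem_preimage, Scheme.Hom.comp_apply] using hy
    · rintro ⟨c, ⟨hc, hcsp⟩, rfl⟩
      refine ⟨⟨c, hc, rfl⟩, ?_⟩
      simpa only [Set.mem_preimage, Scheme.Hom.comp_apply] using hcsp
  rw [h1, hCsp, image_closure_eq_of_isBlowup τ s.ker hτ, himg]

/-- **E-NEG(1) (iii) in FRAME currency, generic-point form — `s(Spec O) ⊆ D♭`.** The exact-shadow SETTING of part 2 (`O` a DVR, `s` a closed
immersion `Spec O → X₁`, `τ : X₂ → X₁` the blow-up along `ker s`, `Γ ⊆ X₁` with `Γ ∖ supp ker s` infinite, `C` an ideal sheaf on `X₂` with `V(C)`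
integral whose special fibre is `closure τ⁻¹(Γ ∖ supp ker s)` as a set, ZERO-DIMENSIONAL fibre of `supp C` over `q = s(s₀)`), `D♭ := τ(supp C)`
closed and HORIZONTAL, a non-closed point `ζ ⤳ q` of `closure (Γ ∖ supp ker s)` (the curve is positive-dimensional at `q`), an ideal sheaf `J`
with `D♭ ⊆ supp J` (planarity, part 1 (i)), `supp J` irreducible and `supp J ⊄ D♭`; and the FRAME at `q`: `𝒪_{X₁,q}` regular of dimension `4`,
`J_q = (c₀)` with `c₀ ∉ 𝔪_q²`, the germ `ϖ_R` of the uniformizer with `ϖ_R ∉ 𝔪_q² + (c₀)`, and `(ker s)_q = (c₀, x₁, x₂)` (the section lies in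
the carrier). THEN `s(Spec O) ⊆ D♭`. Proof: part 2 with `hloc` from part 3b-i, whose ring-level inputs are read off the generic point `η` of
`D♭` (`𝓘(D♭)_q = 𝔭_η`), horizontality (`ϖ_R ∉ 𝔭_η`), planarity (`c₀ ∈ 𝔭_η`), the chains `𝔭_η < 𝔭_ζ < 𝔪_q`, `(0) < (c₀) < 𝔭_η` (`dim = 2`) and
`s(η_O) ∉ D♭` (the `𝔪`-primary clause). [cite: Matsumura1987, Thm. 14.5, Thm. 17.4; StacksProject, Tag 01J7 and Tag 080E] [OURS · L1 W4.5b] -/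
theorem range_subset_image_support_of_exactShadow_of_frame' (r : P ⟶ Spec (.of O)) (τ₁ : X₁ ⟶ P)
    (s : Spec (.of O) ⟶ X₁) [IsClosedImmersion s]
    (τ : X₂ ⟶ X₁) (hτ : IsBlowup τ s.ker) (Γ : Set X₁) (hΓinf : (Γ \ (s.ker.support : Set X₁)).Infinite)
    (C : X₂.IdealSheafData) (hCint : IsIntegral C.subscheme)
    (hCsp : (C.support : Set X₂) ∩ (CategoryStruct.comp τ (CategoryStruct.comp τ₁ r)) ⁻¹' {closedPoint O} =
      closure (τ ⁻¹' (Γ \ (s.ker.support : Set X₁))))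
    (hfib : ∀ c₁ c₀ : X₂, c₁ ∈ (C.support : Set X₂) → c₀ ∈ (C.support : Set X₂) → τ c₁ = s (closedPoint O) →
      τ c₀ = s (closedPoint O) → c₁ ⤳ c₀ → c₁ = c₀)
    (hD : IsClosed (τ '' (C.support : Set X₂)))
    (hhor : ¬ τ '' (C.support : Set X₂) ⊆ (CategoryStruct.comp τ₁ r) ⁻¹' {closedPoint O})
    (hζ : ∃ ζ ∈ closure (Γ \ (s.ker.support : Set X₁)), ζ ⤳ s (closedPoint O) ∧ ζ ≠ s (closedPoint O))
    (J : X₁.IdealSheafData) (hJirr : IsIrreducible (J.support : Set X₁)) (hDJ : τ '' (C.support : Set X₂) ⊆ (J.support : Set X₁))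
    (hJD : ¬ (J.support : Set X₁) ⊆ τ '' (C.support : Set X₂))
    {q : X₁} (hsq : s (closedPoint O) = q) [IsRegularLocalRing (X₁.presheaf.stalk q)] (h4 : ringKrullDim (X₁.presheaf.stalk q) = (4 : ℕ))
    {ϖ : O} (hϖ : Irreducible ϖ) (c₀ x₁ x₂ : X₁.presheaf.stalk q) (hJq : stalkIdeal J q = Ideal.span {c₀})
    (hc₀2 : c₀ ∉ maximalIdeal _ ^ 2)
    (hϖ2 : (X₁.presheaf.Γgerm q).hom ((CategoryStruct.comp τ₁ r).appTop.hom ((Scheme.ΓSpecIso (.of O)).inv.hom ϖ)) ∉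
      maximalIdeal _ ^ 2 ⊔ Ideal.span {c₀})
    (hK : stalkIdeal s.ker q = Ideal.span {c₀, x₁, x₂}) :
    Set.range s ⊆ τ '' (C.support : Set X₂) := by
  classical
  haveI := hCint
  -- notation
  set D : Set X₁ := τ '' (C.support : Set X₂) with hDdef
  set g : Γ(X₁, ⊤) := (CategoryStruct.comp τ₁ r).appTop.hom ((Scheme.ΓSpecIso (.of O)).inv.hom ϖ) with hg
  have hF : X₁.zeroLocus ({g} : Set Γ(X₁, ⊤)) = (CategoryStruct.comp τ₁ r) ⁻¹' {closedPoint O} :=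
    zeroLocus_appTop_eq_preimage_closedPoint hϖ (CategoryStruct.comp τ₁ r)
  -- `q ∈ closure (Γ ∖ supp ker s) ⊆ D ∩ F`
  obtain ⟨ζ, hζcl, hζq, hζne⟩ := hζ
  have hclsub := closure_diff_support_subset_of_exactShadow r τ₁ s τ hτ Γ C hCsp hD
  have hq : s (closedPoint O) ∈ closure (Γ \ (s.ker.support : Set X₁)) := hζq.mem_closed isClosed_closure hζcl
  have hqD : q ∈ D := by rw [← hsq]; exact (hclsub hq).1
  have hqF : q ∈ X₁.zeroLocus ({g} : Set Γ(X₁, ⊤)) := by rw [hF, ← hsq]; exact (hclsub hq).2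
  -- the point `z` of `V(𝓘(D))` over `q`
  set 𝔇 := vanishingIdeal (⟨D, hD⟩ : Closeds X₁) with h𝔇
  have hrange : Set.range 𝔇.subschemeι = D := by
    rw [Scheme.IdealSheafData.range_subschemeι, h𝔇, Scheme.IdealSheafData.coe_support_vanishingIdeal]; rfl
  obtain ⟨z, hz⟩ : q ∈ Set.range 𝔇.subschemeι := by rw [hrange]; exact hqD
  subst hz
  -- `D` is irreducible with generic point `η ⤳ q`, and `𝓘(D)_q = 𝔭_η`
  have hCirr : IsIrreducible (C.support : Set X₂) := by
    rw [← Scheme.IdealSheafData.range_subschemeι, ← Set.image_univ]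
    exact (IrreducibleSpace.isIrreducible_univ _).image _ C.subschemeι.continuous.continuousOn
  have hDirr : IsIrreducible D := hCirr.image _ τ.continuous.continuousOn
  set η := hDirr.genericPoint with hηdef
  have hηD : closure ({η} : Set X₁) = D := hDirr.closure_genericPoint hD
  have hηq : η ⤳ 𝔇.subschemeι z := specializes_iff_mem_closure.mpr (hηD ▸ hqD)
  have h𝔓 : stalkIdeal 𝔇 (𝔇.subschemeι z) = primeOfSpecializes hηq := by
    have h := stalkIdeal_vanishingIdeal_closure (X := X₁) (p := 𝔇.subschemeι z) hηq
    convert h using 3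
    exact Closeds.ext hηD.symm
  have hprime : (stalkIdeal 𝔇 (𝔇.subschemeι z)).IsPrime := by rw [h𝔓]; infer_instance
  -- horizontality: `η ∉ F`, so `ϖ_R ∉ 𝔓`; and `q ∈ F` gives `ϖ_R ∈ 𝔪`
  have hηF : η ∉ X₁.zeroLocus ({g} : Set Γ(X₁, ⊤)) := by
    intro h
    apply hhor
    rw [← hF, ← hηD]
    exact closure_minimal (Set.singleton_subset_iff.mpr h) (X₁.zeroLocus_isClosed _)
  have hϖ𝔓 : (X₁.presheaf.Γgerm (𝔇.subschemeι z)).hom g ∉ stalkIdeal 𝔇 (𝔇.subschemeι z) := by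
    rw [h𝔓, Γgerm_mem_primeOfSpecializes_iff]
    exact hηF
  have hϖm : (X₁.presheaf.Γgerm (𝔇.subschemeι z)).hom g ∈ maximalIdeal _ := by
    have h := (Γgerm_mem_primeOfSpecializes_iff (specializes_refl (𝔇.subschemeι z)) g).mpr hqF
    have hrefl : primeOfSpecializes (specializes_refl (𝔇.subschemeι z)) = maximalIdeal (X₁.presheaf.stalk (𝔇.subschemeι z)) := by
      change (maximalIdeal _).comap (X₁.presheaf.stalkSpecializes (specializes_refl _)).hom = _
      rw [TopCat.Presheaf.stalkSpecializes_refl]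
      exact Ideal.comap_id _
    rwa [hrefl] at h
  -- planarity: `c₀ ∈ 𝔓`, and `c₀ ∈ 𝔪`
  have hηJ : η ∈ (J.support : Set X₁) := hDJ (hηD ▸ subset_closure (Set.mem_singleton η))
  have hJ𝔓 : stalkIdeal J (𝔇.subschemeι z) ≤ stalkIdeal 𝔇 (𝔇.subschemeι z) := by
    rw [h𝔓]; exact (mem_support_iff_stalkIdeal_le_primeOfSpecializes hηq J).mp hηJ
  have hc𝔓 : c₀ ∈ stalkIdeal 𝔇 (𝔇.subschemeι z) := hJ𝔓 (hJq ▸ Ideal.mem_span_singleton_self c₀)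
  have h𝔓m : stalkIdeal 𝔇 (𝔇.subschemeι z) ≤ maximalIdeal _ := IsLocalRing.le_maximalIdeal hprime.ne_top
  have hc₀m : c₀ ∈ maximalIdeal _ := h𝔓m hc𝔓
  -- the centre: `q ∈ supp ker s`, so `x₁, x₂ ∈ 𝔪`
  have hqK : 𝔇.subschemeι z ∈ (s.ker.support : Set X₁) := by
    rw [Scheme.Hom.support_ker, ← hsq]; exact subset_closure ⟨_, rfl⟩
  have hKm : stalkIdeal s.ker (𝔇.subschemeι z) ≤ maximalIdeal _ := by
    have h := (mem_support_iff_stalkIdeal_le_primeOfSpecializes (specializes_refl _) s.ker).mp hqK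
    have hrefl : primeOfSpecializes (specializes_refl (𝔇.subschemeι z)) = maximalIdeal (X₁.presheaf.stalk (𝔇.subschemeι z)) := by
      change (maximalIdeal _).comap (X₁.presheaf.stalkSpecializes (specializes_refl _)).hom = _
      rw [TopCat.Presheaf.stalkSpecializes_refl]
      exact Ideal.comap_id _
    rwa [hrefl] at h
  have hx₁ : x₁ ∈ maximalIdeal _ := hKm (hK ▸ Ideal.subset_span (by simp))
  have hx₂ : x₂ ∈ maximalIdeal _ := hKm (hK ▸ Ideal.subset_span (by simp))
  -- the chain `𝔓 = 𝔭_η < 𝔭_ζ < 𝔪`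
  rw [hsq] at hζq hζne
  have hζD : ζ ∈ D := (hclsub hζcl).1
  have hζF : ζ ∈ X₁.zeroLocus ({g} : Set Γ(X₁, ⊤)) := by rw [hF]; exact (hclsub hζcl).2
  have hηζ : η ⤳ ζ := specializes_iff_mem_closure.mpr (hηD ▸ hζD)
  have hηζne : η ≠ ζ := fun h => hηF (h ▸ hζF)
  have h23 : stalkIdeal 𝔇 (𝔇.subschemeι z) < primeOfSpecializes hζq := by
    rw [h𝔓]; exact primeOfSpecializes_lt_of_ne hζq hηζ hηζne
  have h34 : primeOfSpecializes hζq < maximalIdeal _ := primeOfSpecializes_lt_maximalIdeal hζq hζne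
  -- the chain `(0) < (c₀) < 𝔓`
  obtain ⟨hA, -⟩ := IsRegularLocalRing.quotient_span_singleton hc₀m hc₀2
  haveI : IsDomain (X₁.presheaf.stalk (𝔇.subschemeι z) ⧸ Ideal.span {c₀}) := @isDomain_of_isRegularLocalRing _ _ hA
  haveI hP₁ : (Ideal.span ({c₀} : Set (X₁.presheaf.stalk (𝔇.subschemeι z)))).IsPrime :=
    (Ideal.Quotient.isDomain_iff_prime _).mp inferInstance
  have hP₁ne : Ideal.span ({c₀} : Set (X₁.presheaf.stalk (𝔇.subschemeι z))) ≠ ⊥ := by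
    rw [Ne, Ideal.span_singleton_eq_bot]
    rintro rfl
    exact hc₀2 (Ideal.zero_mem _)
  have h12 : Ideal.span {c₀} < stalkIdeal 𝔇 (𝔇.subschemeι z) := by
    refine lt_of_le_of_ne ((Ideal.span_singleton_le_iff_mem _).mpr hc𝔓) fun heq => hJD ?_
    -- if `𝔓 = (c₀) = J_q` then the generic point `ξ` of `supp J` is `η`, so `supp J = D`
    set ξ := hJirr.genericPoint with hξdef
    have hξJ : closure ({ξ} : Set X₁) = (J.support : Set X₁) := hJirr.closure_genericPoint J.support.isClosed
    have hqJ : 𝔇.subschemeι z ∈ (J.support : Set X₁) := hDJ hqD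
    have hξq : ξ ⤳ 𝔇.subschemeι z := specializes_iff_mem_closure.mpr (hξJ ▸ hqJ)
    have hξη : ξ ⤳ η := specializes_iff_mem_closure.mpr (hξJ ▸ hηJ)
    have hle₁ : primeOfSpecializes (hξη.trans hηq) ≤ primeOfSpecializes hηq := primeOfSpecializes_mono hηq hξη
    have hξJ' : ξ ∈ (J.support : Set X₁) := by rw [← hξJ]; exact subset_closure (Set.mem_singleton ξ)
    have hle₂ : primeOfSpecializes hηq ≤ primeOfSpecializes hξq := by
      rw [← h𝔓, ← heq, ← hJq]
      exact (mem_support_iff_stalkIdeal_le_primeOfSpecializes hξq J).mp hξJ'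
    have hξηeq : ξ = η := by
      by_contra hne
      exact (lt_irrefl _) ((primeOfSpecializes_lt_of_ne hηq hξη hne).trans_le (hle₂.trans (le_of_eq rfl)))
    change (J.support : Set X₁) ⊆ D
    rw [← hξJ, hξηeq, hηD]
  -- `dim R ⧸ 𝔓 = 2`
  haveI := hprime
  have h2 : ringKrullDim (X₁.presheaf.stalk (𝔇.subschemeι z) ⧸ stalkIdeal 𝔇 (𝔇.subschemeι z)) = (2 : ℕ) :=
    ringKrullDim_quotient_eq_two_of_chain h4 hP₁ne h12 h23 h34
  -- part 2 with `hloc` from part 3b-i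
  refine range_subset_image_support_of_exactShadow r τ₁ s τ hτ Γ hΓinf C hCint hCsp hfib hq hD fun hgen => ?_
  -- the `𝔪`-primary clause from `s(η_O) ∉ D`
  have hall : ∀ 𝔯 : Ideal (X₁.presheaf.stalk (𝔇.subschemeι z)), 𝔯.IsPrime → stalkIdeal 𝔇 (𝔇.subschemeι z) ≤ 𝔯 →
      x₁ ∈ 𝔯 → x₂ ∈ 𝔯 → 𝔯 = maximalIdeal _ := by
    intro 𝔯 h𝔯 h𝔓𝔯 h₁ h₂
    let 𝔯' : PrimeSpectrum (X₁.presheaf.stalk (𝔇.subschemeι z)) := ⟨𝔯, h𝔯⟩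
    have hyD : X₁.fromSpecStalk _ 𝔯' ∈ (⟨D, hD⟩ : Closeds X₁) := (fromSpecStalk_mem_iff_stalkIdeal_le _ 𝔯').mpr h𝔓𝔯
    have hyK : X₁.fromSpecStalk _ 𝔯' ∈ (s.ker.support : Set X₁) := by
      refine (mem_support_iff_stalkIdeal_le_primeOfSpecializes (fromSpecStalk_specializes 𝔯') s.ker).mpr ?_
      rw [primeOfSpecializes_fromSpecStalk, hK, Ideal.span_le]
      rintro _ (rfl | rfl | rfl)
      · exact h𝔓𝔯 hc𝔓
      · exact h₁
      · exact h₂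
    rw [Scheme.Hom.support_ker, s.isClosedEmbedding.isClosed_range.closure_eq] at hyK
    obtain ⟨u, hu⟩ := hyK
    rcases eq_closedPoint_or_eq_bot u with h | h
    · rw [h, hsq] at hu
      have hinj := (X₁.fromSpecStalk (𝔇.subschemeι z)).isEmbedding.injective
        (hu.symm.trans Scheme.fromSpecStalk_closedPoint.symm)
      exact congrArg PrimeSpectrum.asIdeal hinj
    · rw [h] at hu
      exact absurd (by rw [hu]; exact hyD) hgen
  obtain ⟨c, hc, hcm, hcq⟩ := exists_isQuasiRegular_pair_of_stalkData 𝔇 z s.ker h4 c₀ _ x₁ x₂ hc₀m hc₀2 hϖm hϖ2 hx₁ hx₂ hK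
    hprime hc𝔓 hϖ𝔓 h2 hall
  exact ⟨z, hsq.symm, 0, c, hc, hcm, hcq⟩

/-- **E-NEG(1) (iii) in FRAME currency — `s(Spec O) ⊆ D♭`** (`range_subset_image_support_of_exactShadow_of_frame'` at `q := s(s₀)`): an exact
shadow whose fibre over `q` is zero-dimensional forces the section INTO the shadow's image, as soon as `D♭` is horizontal, the curve
`closure (Γ ∖ supp ker s)` is positive-dimensional at `q`, `D♭` lies in an irreducible `supp J ⊄ D♭` with `J_q = (c₀)`, `c₀ ∉ 𝔪_q²`, the
uniformizer germ is a regular parameter on the carrier (`ϖ_R ∉ 𝔪_q² + (c₀)`), `𝒪_{X₁,q}` is regular of dimension `4`, and the section lies in the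
carrier (`(ker s)_q = (c₀, x₁, x₂)`). Part 2's `hloc` is DISCHARGED. [cite: Matsumura1987, Thm. 14.5, Thm. 17.4; StacksProject, Tag 01J7 and Tag 080E]
[OURS · L1 W4.5b] -/
theorem range_subset_image_support_of_exactShadow_of_frame (r : P ⟶ Spec (.of O)) (τ₁ : X₁ ⟶ P)
    (s : Spec (.of O) ⟶ X₁) [IsClosedImmersion s]
    (τ : X₂ ⟶ X₁) (hτ : IsBlowup τ s.ker) (Γ : Set X₁) (hΓinf : (Γ \ (s.ker.support : Set X₁)).Infinite)
    (C : X₂.IdealSheafData) (hCint : IsIntegral C.subscheme)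
    (hCsp : (C.support : Set X₂) ∩ (CategoryStruct.comp τ (CategoryStruct.comp τ₁ r)) ⁻¹' {closedPoint O} =
      closure (τ ⁻¹' (Γ \ (s.ker.support : Set X₁))))
    (hfib : ∀ c₁ c₀ : X₂, c₁ ∈ (C.support : Set X₂) → c₀ ∈ (C.support : Set X₂) → τ c₁ = s (closedPoint O) →
      τ c₀ = s (closedPoint O) → c₁ ⤳ c₀ → c₁ = c₀)
    (hD : IsClosed (τ '' (C.support : Set X₂)))
    (hhor : ¬ τ '' (C.support : Set X₂) ⊆ (CategoryStruct.comp τ₁ r) ⁻¹' {closedPoint O})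
    (hζ : ∃ ζ ∈ closure (Γ \ (s.ker.support : Set X₁)), ζ ⤳ s (closedPoint O) ∧ ζ ≠ s (closedPoint O))
    (J : X₁.IdealSheafData) (hJirr : IsIrreducible (J.support : Set X₁)) (hDJ : τ '' (C.support : Set X₂) ⊆ (J.support : Set X₁))
    (hJD : ¬ (J.support : Set X₁) ⊆ τ '' (C.support : Set X₂))
    [IsRegularLocalRing (X₁.presheaf.stalk (s (closedPoint O)))]
    (h4 : ringKrullDim (X₁.presheaf.stalk (s (closedPoint O))) = (4 : ℕ))
    {ϖ : O} (hϖ : Irreducible ϖ) (c₀ x₁ x₂ : X₁.presheaf.stalk (s (closedPoint O)))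
    (hJq : stalkIdeal J (s (closedPoint O)) = Ideal.span {c₀}) (hc₀2 : c₀ ∉ maximalIdeal _ ^ 2)
    (hϖ2 : (X₁.presheaf.Γgerm (s (closedPoint O))).hom
      ((CategoryStruct.comp τ₁ r).appTop.hom ((Scheme.ΓSpecIso (.of O)).inv.hom ϖ)) ∉ maximalIdeal _ ^ 2 ⊔ Ideal.span {c₀})
    (hK : stalkIdeal s.ker (s (closedPoint O)) = Ideal.span {c₀, x₁, x₂}) :
    Set.range s ⊆ τ '' (C.support : Set X₂) :=
  range_subset_image_support_of_exactShadow_of_frame' r τ₁ s τ hτ Γ hΓinf C hCint hCsp hfib hD hhor hζ J hJirr hDJ hJD rfl h4 hϖ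
    c₀ x₁ x₂ hJq hc₀2 hϖ2 hK

/-- **E-NEG(1) (iii) in the EL♮ spelling of part 1 — `s(Spec O) ⊆ D♭ ⊆ E`.** `O` a DVR with uniformizer `ϖ`; `r : P → Spec O` proper, `P` integral
and locally Noetherian; `x` a section of `r`; `τ₁ : X₁ → P` the blow-up along `ker x` with CARRIER `E = τ₁⁻¹(supp ker x)`, irreducible; `s` a closed
immersion `Spec O → X₁`; `τ : X₂ → X₁` the blow-up along `ker s`; `Γ ⊆ E` with `Γ ∖ supp ker s` infinite and positive-dimensional at `q = s(s₀)`
(a non-closed `ζ ⤳ q` in its closure); `C` an ideal sheaf on `X₂` with `V(C)` integral and `O`-flat whose special fibre is `closure τ⁻¹(Γ ∖ supp ker s)`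
and whose fibre over `q` is zero-dimensional; `E ⊄ D♭ := τ(supp C)`; and the FRAME at `q` (`𝒪_{X₁,q}` regular of dimension `4`, `(ker x · 𝒪_{X₁})_q = (c₀)`,
`c₀ ∉ 𝔪²`, `ϖ_R ∉ 𝔪² + (c₀)`, `(ker s)_q = (c₀, x₁, x₂)`). THEN `s(Spec O) ⊆ D♭` — with part 1 (i) `D♭ ⊆ E`: the section is IN-CARRIER and THROUGH THE
LIFT (PLANNER-MEMO-g9-1 §1 (iii)). [cite: Matsumura1987, Thm. 14.5, Thm. 15.5, Thm. 17.4; StacksProject, Tag 01J7 and Tag 080E] [OURS · L1 W4.5b] -/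
theorem range_subset_image_support_of_exactShadow_carrier [IsIntegral P] [IsLocallyNoetherian P] (r : P ⟶ Spec (.of O)) [IsProper r]
    (x : Spec (.of O) ⟶ P) [IsClosedImmersion x] (hx : CategoryStruct.comp x r = CategoryStruct.id _)
    (τ₁ : X₁ ⟶ P) (hτ₁ : IsBlowup τ₁ x.ker) (s : Spec (.of O) ⟶ X₁) [IsClosedImmersion s]
    (τ : X₂ ⟶ X₁) (hτ : IsBlowup τ s.ker)
    (Γ : Set X₁) (hΓE : Γ ⊆ τ₁ ⁻¹' (x.ker.support : Set P)) (hΓinf : (Γ \ (s.ker.support : Set X₁)).Infinite)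
    (C : X₂.IdealSheafData) (hCint : IsIntegral C.subscheme)
    (hflat : Flat (CategoryStruct.comp C.subschemeι (CategoryStruct.comp τ (CategoryStruct.comp τ₁ r))))
    (hCsp : (C.support : Set X₂) ∩ (CategoryStruct.comp τ (CategoryStruct.comp τ₁ r)) ⁻¹' {closedPoint O} =
      closure (τ ⁻¹' (Γ \ (s.ker.support : Set X₁))))
    (hfib : ∀ c₁ c₀ : X₂, c₁ ∈ (C.support : Set X₂) → c₀ ∈ (C.support : Set X₂) → τ c₁ = s (closedPoint O) →
      τ c₀ = s (closedPoint O) → c₁ ⤳ c₀ → c₁ = c₀)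
    (hζ : ∃ ζ ∈ closure (Γ \ (s.ker.support : Set X₁)), ζ ⤳ s (closedPoint O) ∧ ζ ≠ s (closedPoint O))
    (hEirr : IsIrreducible (τ₁ ⁻¹' (x.ker.support : Set P))) (hED : ¬ τ₁ ⁻¹' (x.ker.support : Set P) ⊆ τ '' (C.support : Set X₂))
    [IsRegularLocalRing (X₁.presheaf.stalk (s (closedPoint O)))]
    (h4 : ringKrullDim (X₁.presheaf.stalk (s (closedPoint O))) = (4 : ℕ))
    {ϖ : O} (hϖ : Irreducible ϖ) (c₀ x₁ x₂ : X₁.presheaf.stalk (s (closedPoint O)))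
    (hJq : stalkIdeal (x.ker.comap τ₁) (s (closedPoint O)) = Ideal.span {c₀}) (hc₀2 : c₀ ∉ maximalIdeal _ ^ 2)
    (hϖ2 : (X₁.presheaf.Γgerm (s (closedPoint O))).hom
      ((CategoryStruct.comp τ₁ r).appTop.hom ((Scheme.ΓSpecIso (.of O)).inv.hom ϖ)) ∉ maximalIdeal _ ^ 2 ⊔ Ideal.span {c₀})
    (hK : stalkIdeal s.ker (s (closedPoint O)) = Ideal.span {c₀, x₁, x₂}) :
    Set.range s ⊆ τ '' (C.support : Set X₂) ∧ τ '' (C.support : Set X₂) ⊆ τ₁ ⁻¹' (x.ker.support : Set P) := by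
  obtain ⟨hD, -, hhor, hDE⟩ := image_support_subset_carrier_of_exactShadow r x hx τ₁ hτ₁ s τ hτ Γ hΓE hΓinf C hCint hflat hCsp
  have hsupp : ((x.ker.comap τ₁).support : Set X₁) = τ₁ ⁻¹' (x.ker.support : Set P) := by
    rw [Scheme.IdealSheafData.support_comap]; rfl
  refine ⟨range_subset_image_support_of_exactShadow_of_frame r τ₁ s τ hτ Γ hΓinf C hCint hCsp hfib hD hhor hζ (x.ker.comap τ₁)
    (by rw [hsupp]; exact hEirr) (by rw [hsupp]; exact hDE) (by rw [hsupp]; exact hED) h4 hϖ c₀ x₁ x₂ hJq hc₀2 hϖ2 hK, hDE⟩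

end ExactShadowStalk

end Summit.ResolutionOfSingularities.ResolutionOfSingularities.Cruxes.EquisingularLiftNat.Sections

end
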